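import Mathlib

/-!
# A braid certificate: `T(2,3) ∪ (2,1)-cable of the order-3 fibre` is the closed 3-braid `Δ² σ₁⁴ σ₂`

Kernel certificate for the computational step of Theorem 11.16(d) of the solo-informed notes
(attempt A84, claims C115–C116): the existence of a `c`-invariant once-punctured Klein bottle
bounded by the trefoil in `S³` with fold arc `A₂` (the admissible non-orientable `n = 0` surface of
Question 11.14(o)) was reduced there to the link isotopy
`cl(Δ² σ₁⁴ σ₂) ≅ T(2,3) ∪ C_{2,1}(U′)` (`U′` the order-3 exceptional fibre of the trefoil exterior),
and the right-hand link is the closure of the positive 4-braid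
`β₄ = σ₂σ₁σ₃σ₂σ₂σ₃σ₁σ₂σ₃σ₃σ₃σ₁`.  We certify, in ANY group containing elements `a, b, c`
satisfying the braid relations of `B₄` (so in `B₄` itself), that `β₄` is conjugate to
`β₃ · c` with `β₃ = σ₂σ₁σ₂σ₁σ₁σ₂σ₂σ₁σ₂σ₂σ₂` a word in `a, b` only (`cable_conj_stabilised`), and, in
any group with the `B₃` relation, that `β₃` is conjugate to `Δ² σ₁⁴ σ₂ = (ab)³ a⁴ b` written as
`abababaaaab` (`destabilised_conj_fullTwist`).  The one topological input not formalised is the Markov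
move `cl(β₃ σ₃) = cl(β₃)`.  The chains of braid relations and cyclic shifts were found by the
breadth-first search `work/s11d/braidsearch.py`; here every step is replayed as a group identity.
No topology is formalised here.
-/

namespace Summit.SmoothPoincare4.SmoothPoincare4.Theorems.CableBraidCertificate

/-- Cyclic shift of a word is a conjugation: `x * t` is conjugate to `t * x`. -/
theorem shift {G : Type*} [Group G] (x t : G) : IsConj (x * t) (t * x) :=
  isConj_iff.mpr ⟨x⁻¹, by group⟩

/-- In any group with the `B₄` braid relations (`a = σ₁, b = σ₂, c = σ₃`), the cable braid `β₄ = σ₂σ₁σ₃σ₂σ₂σ₃σ₁σ₂σ₃σ₃σ₃σ₁` is conjugate to `β₃ σ₃` with `β₃ = σ₂σ₁σ₂σ₁σ₁σ₂σ₂σ₁σ₂σ₂σ₂` (no `σ₃`). -/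
theorem cable_conj_stabilised {G : Type*} [Group G] (a b c : G) (hab : a * b * a = b * a * b) (hbc : b * c * b = c * b * c) (hac : a * c = c * a) :
    IsConj (b * (a * (c * (b * (b * (c * (a * (b * (c * (c * (c * (a))))))))))))
      (b * (a * (b * (a * (a * (b * (b * (a * (b * (b * (b * (c)))))))))))) := by
  have hab' : ∀ t : G, a * (b * (a * t)) = b * (a * (b * t)) := fun t => by
    simpa only [mul_assoc] using congrArg (· * t) hab
  have hab'' : a * (b * a) = b * (a * b) := by simpa only [mul_assoc] using hab
  have hbc' : ∀ t : G, b * (c * (b * t)) = c * (b * (c * t)) := fun t => by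
    simpa only [mul_assoc] using congrArg (· * t) hbc
  have hbc'' : b * (c * b) = c * (b * c) := by simpa only [mul_assoc] using hbc
  have hac' : ∀ t : G, a * (c * t) = c * (a * t) := fun t => by
    simpa only [mul_assoc] using congrArg (· * t) hac
  have s0 : IsConj (b * (a * (c * (b * (b * (c * (a * (b * (c * (c * (c * (a)))))))))))) (a * (c * (b * (b * (c * (a * (b * (c * (c * (c * (a * (b)))))))))))) := by
    simpa only [mul_assoc] using shift b (a * (c * (b * (b * (c * (a * (b * (c * (c * (c * (a)))))))))))
  have s1 : IsConj (a * (c * (b * (b * (c * (a * (b * (c * (c * (c * (a * (b)))))))))))) (c * (a * (b * (b * (c * (a * (b * (c * (c * (c * (a * (b)))))))))))) := by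
    rw [hac' (b * (b * (c * (a * (b * (c * (c * (c * (a * (b))))))))))]; try exact IsConj.refl _
  have s2 : IsConj (c * (a * (b * (b * (c * (a * (b * (c * (c * (c * (a * (b)))))))))))) (a * (b * (b * (c * (a * (b * (c * (c * (c * (a * (b * (c)))))))))))) := by
    simpa only [mul_assoc] using shift c (a * (b * (b * (c * (a * (b * (c * (c * (c * (a * (b)))))))))))
  have s3 : IsConj (a * (b * (b * (c * (a * (b * (c * (c * (c * (a * (b * (c)))))))))))) (a * (b * (b * (a * (c * (b * (c * (c * (c * (a * (b * (c)))))))))))) := by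
    rw [← hac' (b * (c * (c * (c * (a * (b * (c)))))))]; try exact IsConj.refl _
  have s4 : IsConj (a * (b * (b * (a * (c * (b * (c * (c * (c * (a * (b * (c)))))))))))) (a * (b * (b * (a * (b * (c * (b * (c * (c * (a * (b * (c)))))))))))) := by
    rw [← hbc' (c * (c * (a * (b * (c)))))]; try exact IsConj.refl _
  have s5 : IsConj (a * (b * (b * (a * (b * (c * (b * (c * (c * (a * (b * (c)))))))))))) (a * (b * (a * (b * (a * (c * (b * (c * (c * (a * (b * (c)))))))))))) := by
    rw [← hab' (c * (b * (c * (c * (a * (b * (c)))))))]; try exact IsConj.refl _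
  have s6 : IsConj (a * (b * (a * (b * (a * (c * (b * (c * (c * (a * (b * (c)))))))))))) (a * (a * (b * (a * (a * (c * (b * (c * (c * (a * (b * (c)))))))))))) := by
    rw [← hab' (a * (c * (b * (c * (c * (a * (b * (c))))))))]; try exact IsConj.refl _
  have s7 : IsConj (a * (a * (b * (a * (a * (c * (b * (c * (c * (a * (b * (c)))))))))))) (a * (a * (b * (a * (a * (b * (c * (b * (c * (a * (b * (c)))))))))))) := by
    rw [← hbc' (c * (a * (b * (c))))]; try exact IsConj.refl _
  have s8 : IsConj (a * (a * (b * (a * (a * (b * (c * (b * (c * (a * (b * (c)))))))))))) (a * (a * (b * (a * (a * (b * (c * (b * (a * (c * (b * (c)))))))))))) := by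
    rw [← hac' (b * (c))]; try exact IsConj.refl _
  have s9 : IsConj (a * (a * (b * (a * (a * (b * (c * (b * (a * (c * (b * (c)))))))))))) (a * (a * (b * (a * (a * (b * (c * (b * (a * (b * (c * (b)))))))))))) := by
    rw [← hbc'']; try exact IsConj.refl _
  have s10 : IsConj (a * (a * (b * (a * (a * (b * (c * (b * (a * (b * (c * (b)))))))))))) (a * (a * (b * (a * (a * (b * (c * (a * (b * (a * (c * (b)))))))))))) := by
    rw [← hab' (c * (b))]; try exact IsConj.refl _
  have s11 : IsConj (a * (a * (b * (a * (a * (b * (c * (a * (b * (a * (c * (b)))))))))))) (a * (a * (b * (a * (a * (b * (a * (c * (b * (a * (c * (b)))))))))))) := by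
    rw [← hac' (b * (a * (c * (b))))]; try exact IsConj.refl _
  have s12 : IsConj (a * (a * (b * (a * (a * (b * (a * (c * (b * (a * (c * (b)))))))))))) (a * (a * (b * (a * (b * (a * (b * (c * (b * (a * (c * (b)))))))))))) := by
    rw [hab' (c * (b * (a * (c * (b)))))]; try exact IsConj.refl _
  have s13 : IsConj (a * (a * (b * (a * (b * (a * (b * (c * (b * (a * (c * (b)))))))))))) (a * (a * (b * (b * (a * (b * (b * (c * (b * (a * (c * (b)))))))))))) := by
    rw [hab' (b * (c * (b * (a * (c * (b))))))]; try exact IsConj.refl _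
  have s14 : IsConj (a * (a * (b * (b * (a * (b * (b * (c * (b * (a * (c * (b)))))))))))) (a * (a * (b * (b * (a * (b * (b * (c * (b * (c * (a * (b)))))))))))) := by
    rw [hac' (b)]; try exact IsConj.refl _
  have s15 : IsConj (a * (a * (b * (b * (a * (b * (b * (c * (b * (c * (a * (b)))))))))))) (a * (a * (b * (b * (a * (b * (b * (b * (c * (b * (a * (b)))))))))))) := by
    rw [← hbc' (a * (b))]; try exact IsConj.refl _
  have s16 : IsConj (a * (a * (b * (b * (a * (b * (b * (b * (c * (b * (a * (b)))))))))))) (a * (b * (b * (a * (b * (b * (b * (c * (b * (a * (b * (a)))))))))))) := by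
    simpa only [mul_assoc] using shift a (a * (b * (b * (a * (b * (b * (b * (c * (b * (a * (b)))))))))))
  have s17 : IsConj (a * (b * (b * (a * (b * (b * (b * (c * (b * (a * (b * (a)))))))))))) (b * (b * (a * (b * (b * (b * (c * (b * (a * (b * (a * (a)))))))))))) := by
    simpa only [mul_assoc] using shift a (b * (b * (a * (b * (b * (b * (c * (b * (a * (b * (a)))))))))))
  have s18 : IsConj (b * (b * (a * (b * (b * (b * (c * (b * (a * (b * (a * (a)))))))))))) (b * (a * (b * (b * (b * (c * (b * (a * (b * (a * (a * (b)))))))))))) := by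
    simpa only [mul_assoc] using shift b (b * (a * (b * (b * (b * (c * (b * (a * (b * (a * (a)))))))))))
  have s19 : IsConj (b * (a * (b * (b * (b * (c * (b * (a * (b * (a * (a * (b)))))))))))) (a * (b * (b * (b * (c * (b * (a * (b * (a * (a * (b * (b)))))))))))) := by
    simpa only [mul_assoc] using shift b (a * (b * (b * (b * (c * (b * (a * (b * (a * (a * (b)))))))))))
  have s20 : IsConj (a * (b * (b * (b * (c * (b * (a * (b * (a * (a * (b * (b)))))))))))) (b * (b * (b * (c * (b * (a * (b * (a * (a * (b * (b * (a)))))))))))) := by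
    simpa only [mul_assoc] using shift a (b * (b * (b * (c * (b * (a * (b * (a * (a * (b * (b)))))))))))
  have s21 : IsConj (b * (b * (b * (c * (b * (a * (b * (a * (a * (b * (b * (a)))))))))))) (b * (b * (c * (b * (a * (b * (a * (a * (b * (b * (a * (b)))))))))))) := by
    simpa only [mul_assoc] using shift b (b * (b * (c * (b * (a * (b * (a * (a * (b * (b * (a)))))))))))
  have s22 : IsConj (b * (b * (c * (b * (a * (b * (a * (a * (b * (b * (a * (b)))))))))))) (b * (c * (b * (a * (b * (a * (a * (b * (b * (a * (b * (b)))))))))))) := by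
    simpa only [mul_assoc] using shift b (b * (c * (b * (a * (b * (a * (a * (b * (b * (a * (b)))))))))))
  have s23 : IsConj (b * (c * (b * (a * (b * (a * (a * (b * (b * (a * (b * (b)))))))))))) (c * (b * (a * (b * (a * (a * (b * (b * (a * (b * (b * (b)))))))))))) := by
    simpa only [mul_assoc] using shift b (c * (b * (a * (b * (a * (a * (b * (b * (a * (b * (b)))))))))))
  have s24 : IsConj (c * (b * (a * (b * (a * (a * (b * (b * (a * (b * (b * (b)))))))))))) (b * (a * (b * (a * (a * (b * (b * (a * (b * (b * (b * (c)))))))))))) := by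
    simpa only [mul_assoc] using shift c (b * (a * (b * (a * (a * (b * (b * (a * (b * (b * (b)))))))))))
  exact ((((((((((((((((((((((((s0).trans s1).trans s2).trans s3).trans s4).trans s5).trans s6).trans s7).trans s8).trans s9).trans s10).trans s11).trans s12).trans s13).trans s14).trans s15).trans s16).trans s17).trans s18).trans s19).trans s20).trans s21).trans s22).trans s23).trans s24

/-- In any group with the `B₃` braid relation (`a = σ₁, b = σ₂`), `β₃ = σ₂σ₁σ₂σ₁σ₁σ₂σ₂σ₁σ₂σ₂σ₂` is conjugate to `Δ² σ₁⁴ σ₂ = σ₁σ₂σ₁σ₂σ₁σ₂σ₁σ₁σ₁σ₁σ₂`. -/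
theorem destabilised_conj_fullTwist {G : Type*} [Group G] (a b : G) (hab : a * b * a = b * a * b) :
    IsConj (b * (a * (b * (a * (a * (b * (b * (a * (b * (b * (b)))))))))))
      (a * (b * (a * (b * (a * (b * (a * (a * (a * (a * (b))))))))))) := by
  have hab' : ∀ t : G, a * (b * (a * t)) = b * (a * (b * t)) := fun t => by
    simpa only [mul_assoc] using congrArg (· * t) hab
  have hab'' : a * (b * a) = b * (a * b) := by simpa only [mul_assoc] using hab
  have s0 : IsConj (b * (a * (b * (a * (a * (b * (b * (a * (b * (b * (b))))))))))) (b * (a * (b * (a * (a * (b * (a * (b * (a * (b * (b))))))))))) := by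
    rw [← hab' (b * (b))]; try exact IsConj.refl _
  have s1 : IsConj (b * (a * (b * (a * (a * (b * (a * (b * (a * (b * (b))))))))))) (b * (a * (b * (a * (a * (b * (a * (a * (b * (a * (b))))))))))) := by
    rw [← hab' (b)]; try exact IsConj.refl _
  have s2 : IsConj (b * (a * (b * (a * (a * (b * (a * (a * (b * (a * (b))))))))))) (b * (a * (b * (a * (a * (b * (a * (a * (a * (b * (a))))))))))) := by
    rw [← hab'']; try exact IsConj.refl _
  have s3 : IsConj (b * (a * (b * (a * (a * (b * (a * (a * (a * (b * (a))))))))))) (a * (b * (a * (a * (b * (a * (a * (a * (b * (a * (b))))))))))) := by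
    simpa only [mul_assoc] using shift b (a * (b * (a * (a * (b * (a * (a * (a * (b * (a))))))))))
  have s4 : IsConj (a * (b * (a * (a * (b * (a * (a * (a * (b * (a * (b))))))))))) (a * (b * (a * (a * (b * (a * (a * (a * (a * (b * (a))))))))))) := by
    rw [← hab'']; try exact IsConj.refl _
  have s5 : IsConj (a * (b * (a * (a * (b * (a * (a * (a * (a * (b * (a))))))))))) (b * (a * (b * (a * (b * (a * (a * (a * (a * (b * (a))))))))))) := by
    rw [hab' (a * (b * (a * (a * (a * (a * (b * (a))))))))]; try exact IsConj.refl _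
  have s6 : IsConj (b * (a * (b * (a * (b * (a * (a * (a * (a * (b * (a))))))))))) (a * (b * (a * (b * (a * (b * (a * (a * (a * (a * (b))))))))))) := by
    simpa only [mul_assoc] using (shift a (b * (a * (b * (a * (b * (a * (a * (a * (a * (b))))))))))).symm
  exact ((((((s0).trans s1).trans s2).trans s3).trans s4).trans s5).trans s6

end Summit.SmoothPoincare4.SmoothPoincare4.Theorems.CableBraidCertificate
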